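import Summits.HubbardSuperconductivity.HubbardSuperconductivity.Theses.CooperPairDMottWalk
import Literature.MathematicalPhysics.QuantumLattice.HubbardWave0LiebProofs

/-!
# Route `CooperPairDMottWalk`: refutation of support `BreathingSelfDual` AS TYPED
(stmt-HubbardSuperconductivity-1180)

`BreathingSelfDual` quantifies over EVERY even side `L` (with `[NeZero L]`), including the
degenerate side `L = 2`. On the `2 × 2` torus the plaquette label `x ↦ (⌊x₁/2⌋, ⌊x₂/2⌋)` is
constant, so the "different plaquette" relation `P = ⊤.comap plaq` has no edges: every bond of
`G = fermionTorusGraph 2 2` (the 4-cycle) is intra-plaquette, `G \ P = G` edge-wise and `G ⊓ P = ⊥`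
edge-wise. Hence `Hb 2 a b U = hamiltonian (G \ P) a U + 0`-hopping and, with
`(a, b, U) = (1, 0, 0)`, the asserted conjugacy `W · Hb 2 1 0 0 · W⋆ = Hb 2 0 1 0 = 0` with `W`
unitary forces the free hopping operator `dΓ(h)` of the 4-cycle to vanish — but its one-particle
matrix element `⟨{(0,0)↑}| Hb 2 1 0 0 |{(1,0)↑}⟩` equals `-1`. So the item is FALSE as typed
(class: refuted-misstated — the witness exploits the missing side condition `4 ≤ L`).

REPAIR `C′` (planner): add the hypothesis `4 ≤ L` (the route only ever uses `L = 4k + 4`):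
`∀ L [NeZero L] a b U, Even L → 4 ≤ L → ∃ W unitary, W Hb(a,b,U) W⋆ = Hb(b,a,U) ∧ W N W⋆ = N ∧
W Sᶻ W⋆ = Sᶻ ∧ W Δ_d W⋆ = Δ_d`. `C′` is ALREADY PROVED in the tree:
`Literature.MathematicalPhysics.QuantumLattice.breathingSelfDual_of_four_le`
(`Literature/MathematicalPhysics/QuantumLattice/PlaquetteBreathingSelfDuality.lean`, translation
unitary `fockTranslate (1,1)`); the witness `L = 2` misses `C′`. The restated item closes by a
one-line wrapper around that theorem.

Sources: route card cooper-theorem-breathing-self-dual (Yao–Tsai–Kivelson 2007) for the intended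
statement; the counterexample is elementary bookkeeping.

Maintenance note (fullbuild repair 2026-08-16): after this refutation landed the item `BreathingSelfDual`
(stmt-HubbardSuperconductivity-1180, closed `refuted`) was dropped from the route (rev 8) and the Theses
module stopped declaring `Theses.CooperPairDMottWalk.BreathingSelfDual`, so `not_breathingSelfDual` lost its
subject. The refuted statement is therefore restated below VERBATIM (the item's registered signature) as the
`@[conjecture] def BreathingSelfDual` of this namespace — the only definition in the file, a `Prop` never
used as a hypothesis — and `not_breathingSelfDual : ¬ BreathingSelfDual` is unchanged.
-/

set_option linter.dupNamespace false

namespace Summit.HubbardSuperconductivity.HubbardSuperconductivity.Theorems.CooperPairDMottWalk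

open Literature.MathematicalPhysics.QuantumLattice
open Summit.HubbardSuperconductivity.HubbardSuperconductivity.Theses.CooperPairDMottWalk

/-! ### The refuted statement, kept by name -/

/-- REFUTED STATEMENT — **breathing self-duality for EVERY even side** [status: refuted as typed, by
`not_breathingSelfDual` below; class refuted-misstated]: for every even `L` (with `[NeZero L]`, hence
including the degenerate side `L = 2`) and all `(a, b, U)` there is a unitary `W` on the Fock space of the
`2 × L`… `L × L` fermion torus conjugating the breathing Hamiltonian `Hb L a b U` (intra-plaquette hopping
`a`, inter-plaquette hopping `b`, on-site `U`) to `Hb L b a U` and commuting with the total number, `Sᶻ` and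
the d-wave pair field. Literally the registered signature of the former support item `BreathingSelfDual`
(stmt-HubbardSuperconductivity-1180) of route `CooperPairDMottWalk`, which this file refuted; the item was
then DROPPED from the route (rev 8, 2026-08-16T12:17Z) and replaced by the repaired `BreathingSelfDualFourLe`
(`4 ≤ L`; proved in Literature as `breathingSelfDual_of_four_le`), so the Theses module no longer declares the
name. It is kept HERE, verbatim, as an `@[conjecture]`-tagged `Prop` (an obligation node refuted by name in
this very file — never a hypothesis of anything), so that the landed kill `not_breathingSelfDual` keeps its
statement byte-identical (Theorems files are append-only). Intended (true) statement: Yao–Tsai–Kivelson 2007,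
diagonal translation `x ↦ x + (1,1)` for `L ≥ 4`. [folklore] -/
@[conjecture] def BreathingSelfDual : Prop :=
  open Literature.MathematicalPhysics.QuantumLattice in let Hb := fun (L : ℕ) (a b U : ℝ) => hamiltonian (fermionTorusGraph 2 L \ (⊤ : SimpleGraph (Fin 2 → ℕ)).comap (fun (x : FermionTorus 2 L) (i : Fin 2) => (ofLex x i : ℕ) / 2)) a U + hamiltonian (fermionTorusGraph 2 L ⊓ (⊤ : SimpleGraph (Fin 2 → ℕ)).comap (fun (x : FermionTorus 2 L) (i : Fin 2) => (ofLex x i : ℕ) / 2)) b 0; ∀ (L : ℕ) [NeZero L] (a b U : ℝ), Even L → ∃ W : Matrix (Finset (Orb (FermionTorus 2 L))) (Finset (Orb (FermionTorus 2 L))) ℂ, W ∈ Matrix.unitaryGroup (Finset (Orb (FermionTorus 2 L))) ℂ ∧ W * Hb L a b U * star W = Hb L b a U ∧ W * totalNumber * star W = totalNumber ∧ W * HubbardWave0.spinZ * star W = HubbardWave0.spinZ ∧ W * pairField dWaveFormFactor L * star W = pairField dWaveFormFactor L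

/-! ### One-particle matrix elements of the hopping term -/

section OneParticle

variable {Λ : Type*} [LinearOrder Λ] [Fintype Λ]

/-- One-particle matrix elements of a fermion bilinear: `⟨{i₀}| c†_i c_j |{j₀}⟩ = [i = i₀][j = j₀]`
(no Jordan–Wigner sign on singly occupied configurations). [folklore] -/
theorem creation_mul_annihilation_apply_singleton {ι : Type*} [LinearOrder ι] [Fintype ι]
    (i j i₀ j₀ : ι) :
    (creation i * annihilation j) {i₀} {j₀} = if i = i₀ ∧ j = j₀ then 1 else 0 := by
  rw [LiebThm1.creation_mul_annihilation_apply]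
  by_cases hi : i = i₀
  · subst hi
    rw [Finset.erase_singleton, Finset.insert_empty]
    by_cases hj : j = j₀
    · subst hj
      rw [if_pos ⟨Finset.mem_singleton_self _, Finset.notMem_empty _, rfl⟩, if_pos ⟨rfl, rfl⟩]
      simp [jwSign]
    · rw [if_neg (show ¬(i ∈ ({i} : Finset ι) ∧ j ∉ (∅ : Finset ι) ∧ ({j₀} : Finset ι) = {j})
          from fun h3 => hj (Finset.singleton_inj.1 h3.2.2).symm), if_neg fun h3 => hj h3.2]
  · rw [if_neg fun h3 => hi (Finset.mem_singleton.1 h3.1), if_neg fun h3 => hi h3.1]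

/-- One-particle matrix element of the hopping sum across an (oriented) edge `x₀ ∼ y₀`:
`⟨{(x₀,↑)}| Σ_{x∼y,σ} c†_{xσ} c_{yσ} |{(y₀,↑)}⟩ = 1`. [folklore] -/
theorem hoppingSum_apply_singleton (X : SimpleGraph Λ) [DecidableRel X.Adj] {x₀ y₀ : Λ}
    (h : X.Adj x₀ y₀) :
    (∑ x : Λ, ∑ y : Λ, ∑ σ : Fin 2,
        if X.Adj x y then creation (orb x σ) * annihilation (orb y σ) else
          (0 : Matrix (Finset (Orb Λ)) (Finset (Orb Λ)) ℂ)) {orb x₀ 0} {orb y₀ 0} = 1 := by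
  have key : ∀ (x y : Λ) (σ : Fin 2),
      (if X.Adj x y then creation (orb x σ) * annihilation (orb y σ) else
          (0 : Matrix (Finset (Orb Λ)) (Finset (Orb Λ)) ℂ)) {orb x₀ 0} {orb y₀ 0} =
        if σ = 0 then (if y = y₀ then (if x = x₀ then 1 else 0) else 0) else 0 := by
    intro x y σ
    by_cases hA : X.Adj x y
    · rw [if_pos hA, creation_mul_annihilation_apply_singleton]
      by_cases hx : x = x₀ <;> by_cases hy : y = y₀ <;> by_cases hσ : σ = 0 <;>
        simp [hx, hy, hσ, orb]
    · rw [if_neg hA, Matrix.zero_apply]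
      by_cases hσ : σ = 0
      · by_cases hy : y = y₀
        · subst hy
          by_cases hx : x = x₀
          · subst hx
            exact absurd h hA
          · rw [if_pos hσ, if_pos rfl, if_neg hx]
        · rw [if_pos hσ, if_neg hy]
      · rw [if_neg hσ]
  simp only [Matrix.sum_apply, key, Finset.sum_ite_eq', Finset.mem_univ, if_true]

variable (X : SimpleGraph Λ) [DecidableRel X.Adj]

/-- The Hubbard Hamiltonian with `t = U = 0` is the zero operator. [folklore] -/
theorem hamiltonian_zero_zero : hamiltonian X 0 0 = 0 := by
  unfold hamiltonian
  rw [Complex.ofReal_zero, neg_zero, zero_smul, zero_smul, add_zero]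

/-- On a graph without edges the free (`U = 0`) Hubbard Hamiltonian vanishes. [folklore] -/
theorem hamiltonian_eq_zero_of_forall_not_adj (hX : ∀ x y, ¬ X.Adj x y) (t : ℝ) :
    hamiltonian X t 0 = 0 := by
  have hS : (∑ x : Λ, ∑ y : Λ, ∑ σ : Fin 2,
      if X.Adj x y then creation (orb x σ) * annihilation (orb y σ) else
        (0 : Matrix (Finset (Orb Λ)) (Finset (Orb Λ)) ℂ)) = 0 :=
    Finset.sum_eq_zero fun x _ => Finset.sum_eq_zero fun y _ =>
      Finset.sum_eq_zero fun σ _ => if_neg (hX x y)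
  unfold hamiltonian
  rw [hS, Complex.ofReal_zero, zero_smul, add_zero, smul_zero]

/-- One-particle matrix element of the free Hubbard Hamiltonian across an edge `x₀ ∼ y₀`:
`⟨{(x₀,↑)}| H(t,0) |{(y₀,↑)}⟩ = -t` (the second quantisation `dΓ(-t·adj)`). [folklore] -/
theorem hamiltonian_apply_singleton {x₀ y₀ : Λ} (h : X.Adj x₀ y₀) (t : ℝ) :
    hamiltonian X t 0 {orb x₀ 0} {orb y₀ 0} = -(t : ℂ) := by
  unfold hamiltonian
  rw [Complex.ofReal_zero, zero_smul, add_zero, Matrix.smul_apply,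
    hoppingSum_apply_singleton X h, smul_eq_mul, mul_one]

end OneParticle

/-! ### Unitary conjugation -/

/-- A matrix unitarily conjugate to `0` is `0`. [folklore] -/
theorem eq_zero_of_unitary_conj_eq_zero {n : Type*} [Fintype n] [DecidableEq n]
    {W A : Matrix n n ℂ} (hW : W ∈ Matrix.unitaryGroup n ℂ) (h : W * A * star W = 0) :
    A = 0 := by
  have h1 : star W * (W * A * star W) * W = A := by
    calc star W * (W * A * star W) * W = (star W * W) * A * (star W * W) := by
          simp only [Matrix.mul_assoc]
      _ = A := by rw [hW.1, Matrix.one_mul, Matrix.mul_one]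
  rw [← h1, h, Matrix.mul_zero, Matrix.zero_mul]

/-! ### The degenerate side `L = 2` -/

/-- On the `2 × 2` torus the plaquette label `x ↦ (⌊x₁/2⌋, ⌊x₂/2⌋)` is constant, so the
"different plaquette" relation has no edges. [folklore] -/
theorem plaquette_not_adj_two (x y : FermionTorus 2 2) :
    ¬ ((⊤ : SimpleGraph (Fin 2 → ℕ)).comap
        (fun (x : FermionTorus 2 2) (i : Fin 2) => (ofLex x i : ℕ) / 2)).Adj x y := by
  intro hxy
  rw [SimpleGraph.comap_adj, SimpleGraph.top_adj] at hxy
  apply hxy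
  funext i
  rw [Nat.div_eq_of_lt (ofLex x i).isLt, Nat.div_eq_of_lt (ofLex y i).isLt]

/-- The bond `(0,0) ∼ (1,0)` of the `2 × 2` torus (the 4-cycle). [folklore] -/
theorem fermionTorusGraph_two_adj :
    (fermionTorusGraph 2 2).Adj (toLex ![0, 0]) (toLex ![1, 0]) := by
  decide

/-- **Core of the counterexample.** At `L = 2` no unitary conjugates the breathing Hamiltonian
`Hb 2 1 0 0` (= the free 4-cycle hopping) to `Hb 2 0 1 0` (= `0`). [folklore] -/
theorem breathing_two_not_conj
    (W : Matrix (Finset (Orb (FermionTorus 2 2))) (Finset (Orb (FermionTorus 2 2))) ℂ)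
    {dec : DecidableEq (Finset (Orb (FermionTorus 2 2)))}
    (hW : W ∈ @Matrix.unitaryGroup (Finset (Orb (FermionTorus 2 2))) dec _ ℂ _ _)
    {d₁ : DecidableRel (fermionTorusGraph 2 2 \ (⊤ : SimpleGraph (Fin 2 → ℕ)).comap
        (fun (x : FermionTorus 2 2) (i : Fin 2) => (ofLex x i : ℕ) / 2)).Adj}
    {d₂ : DecidableRel (fermionTorusGraph 2 2 ⊓ (⊤ : SimpleGraph (Fin 2 → ℕ)).comap
        (fun (x : FermionTorus 2 2) (i : Fin 2) => (ofLex x i : ℕ) / 2)).Adj} :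
    W * (@hamiltonian _ _ _ (fermionTorusGraph 2 2 \ (⊤ : SimpleGraph (Fin 2 → ℕ)).comap
          (fun (x : FermionTorus 2 2) (i : Fin 2) => (ofLex x i : ℕ) / 2)) d₁ 1 0 +
        @hamiltonian _ _ _ (fermionTorusGraph 2 2 ⊓ (⊤ : SimpleGraph (Fin 2 → ℕ)).comap
          (fun (x : FermionTorus 2 2) (i : Fin 2) => (ofLex x i : ℕ) / 2)) d₂ 0 0) * star W ≠
      @hamiltonian _ _ _ (fermionTorusGraph 2 2 \ (⊤ : SimpleGraph (Fin 2 → ℕ)).comap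
          (fun (x : FermionTorus 2 2) (i : Fin 2) => (ofLex x i : ℕ) / 2)) d₁ 0 0 +
        @hamiltonian _ _ _ (fermionTorusGraph 2 2 ⊓ (⊤ : SimpleGraph (Fin 2 → ℕ)).comap
          (fun (x : FermionTorus 2 2) (i : Fin 2) => (ofLex x i : ℕ) / 2)) d₂ 1 0 := by
  intro hconj
  rw [hamiltonian_zero_zero, hamiltonian_zero_zero, add_zero, zero_add,
    hamiltonian_eq_zero_of_forall_not_adj _
      (fun x y hxy => plaquette_not_adj_two x y ((SimpleGraph.inf_adj _ _ _ _).1 hxy).2)] at hconj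
  have hA := eq_zero_of_unitary_conj_eq_zero hW hconj
  have hadj : (fermionTorusGraph 2 2 \ (⊤ : SimpleGraph (Fin 2 → ℕ)).comap
      (fun (x : FermionTorus 2 2) (i : Fin 2) => (ofLex x i : ℕ) / 2)).Adj
      (toLex ![0, 0]) (toLex ![1, 0]) :=
    (SimpleGraph.sdiff_adj _ _ _ _).2 ⟨fermionTorusGraph_two_adj, plaquette_not_adj_two _ _⟩
  have hentry := hamiltonian_apply_singleton _ hadj 1
  rw [hA, Matrix.zero_apply, Complex.ofReal_one] at hentry
  exact neg_ne_zero.2 one_ne_zero hentry.symm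

/-- **`BreathingSelfDual` is false as typed** (route `CooperPairDMottWalk`, support item
`stmt-HubbardSuperconductivity-1180`; class `refuted-misstated`). Witness: `L = 2`,
`(a, b, U) = (1, 0, 0)` — on the `2 × 2` torus all four sites lie in one plaquette, so
`Hb 2 0 1 0 = 0` while `Hb 2 1 0 0` is the free 4-cycle hopping with matrix element
`⟨{(0,0)↑}| · |{(1,0)↑}⟩ = -1 ≠ 0`; no unitary conjugates a nonzero matrix to `0`.
Repaired statement `C′`: the same conclusion under the extra hypothesis `4 ≤ L`, proved as
`Literature.MathematicalPhysics.QuantumLattice.breathingSelfDual_of_four_le`; the witness `L = 2`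
misses `C′`. [folklore] -/
theorem not_breathingSelfDual : ¬ BreathingSelfDual := by
  intro h
  obtain ⟨W, hW, hconj, -, -, -⟩ := h 2 1 0 0 even_two
  exact breathing_two_not_conj W hW hconj

end Summit.HubbardSuperconductivity.HubbardSuperconductivity.Theorems.CooperPairDMottWalk
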